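import Literature.Probability.RandomPlanarGeometry.SAWFiniteMemoryZ3K10
import Literature.Probability.RandomPlanarGeometry.SAWFiniteMemory18At2688
import HarnessLib

/-!
# Explicit exponential bounds on the self-avoiding-walk counts of `ℤ³` and `ℤ²` from the tree's finite-memory certificates:
# `c_ℓ(ℤ³) ≤ 2⁴¹ · 4.76^ℓ` and `c_ℓ(ℤ²) ≤ 2⁴¹ · 2.688^ℓ` for every `ℓ`

Topic `Literature/Probability/RandomPlanarGeometry`. Theorem-only file (no definition, no named fact, no sorry); COMPUTATIONAL: both bounds
are the real-number form of the tree's kernel-checked Pönitz–Tittmann certificates, which rest on one `native_decide` evaluation each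
(`FiniteMemory3.check_10` for `ℤ³`, 139 183 states, ratio `4760/1000`, `SAWFiniteMemoryZ3K10.lean`; `FiniteMemory.checkC_18_2688` for `ℤ²`,
reduced memory-18 automaton, ratio `2688/1000`, `SAWFiniteMemory18At2688.lean`).  The certificates are stated in the tree as
`cₙ · Dⁿ ≤ Nⁿ · 2⁴¹` over `ℕ` (`count_mul_pow_le_of_check`, `count_mul_pow_le_of_checkC`); consumers that feed a counting bound
`c_ℓ ≤ A · λ^ℓ` into an analytic estimate (e.g. Fisher's self-avoiding-walk bound for Ising correlations, or the Wilson-loop bounds of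
`Summits/Ventures/YMGap/RobustBall/CentreBlindSAWRate.lean`) want the real form:

* `count_three_le_pow_476` — **`(c_ℓ(ℤ³) : ℝ) ≤ 2⁴¹ · 4.76^ℓ`** (Pönitz–Tittmann Table 2, `d = 3`, `k = 10`: `4.7599`);
* `count_two_le_pow_2688` — **`(c_ℓ(ℤ²) : ℝ) ≤ 2⁴¹ · 2.688^ℓ`** (Table 2, `d = 2`, `k = 18`: `2.6871`; `SAW.count = SAW.Zd.count 2`).

References: A. Pönitz, P. Tittmann, *Improved upper bounds for self-avoiding walks in ℤᵈ*, Electron. J. Combin. 7 (2000) R21, Table 2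
[PonitzTittmann2000]; N. Madras, G. Slade, *The Self-Avoiding Walk* (1993), §1.2 [MadrasSlade1993].
-/

noncomputable section

namespace Literature.Probability.RandomPlanarGeometry.SAW.Zd

/-- **`c_ℓ(ℤ³) ≤ 2⁴¹ · 4.76^ℓ`** for every `ℓ` — the real form of the kernel-checked memory-10 certificate `c_ℓ·1000^ℓ ≤ 4760^ℓ·2⁴¹`
(`FiniteMemory3.count_mul_pow_le_of_check FiniteMemory3.check_10`). [cite: PonitzTittmann2000, Table 2 (d = 3, k = 10)] -/
theorem count_three_le_pow_476 (ℓ : ℕ) : (count 3 ℓ : ℝ) ≤ 2 ^ 41 * (4.76 : ℝ) ^ ℓ := by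
  have h := FiniteMemory3.count_mul_pow_le_of_check FiniteMemory3.check_10 ℓ
  have h' : (count 3 ℓ : ℝ) * (1000 : ℝ) ^ ℓ ≤ (4760 : ℝ) ^ ℓ * 2 ^ 41 := by exact_mod_cast h
  have h476 : (4.76 : ℝ) = 4760 / 1000 := by norm_num
  rw [h476, div_pow, mul_div_assoc', le_div_iff₀ (by positivity)]
  linarith

/-- **`c_ℓ(ℤ²) ≤ 2⁴¹ · 2.688^ℓ`** for every `ℓ` — the real form of the kernel-checked reduced memory-18 certificate `c_ℓ·1000^ℓ ≤ 2688^ℓ·2⁴¹`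
for the square lattice (`FiniteMemory.count_mul_pow_le_of_checkC FiniteMemory.checkC_18_2688`; `SAW.count = SAW.Zd.count 2`, `count_two`).
[cite: PonitzTittmann2000, Table 2 (d = 2, k = 18)] -/
theorem count_two_le_pow_2688 (ℓ : ℕ) : (count 2 ℓ : ℝ) ≤ 2 ^ 41 * (2.688 : ℝ) ^ ℓ := by
  have h := Literature.Probability.RandomPlanarGeometry.SAW.FiniteMemory.count_mul_pow_le_of_checkC
    Literature.Probability.RandomPlanarGeometry.SAW.FiniteMemory.checkC_18_2688 ℓ
  rw [← count_two] at h
  have h' : (count 2 ℓ : ℝ) * (1000 : ℝ) ^ ℓ ≤ (2688 : ℝ) ^ ℓ * 2 ^ 41 := by exact_mod_cast h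
  have h2688 : (2.688 : ℝ) = 2688 / 1000 := by norm_num
  rw [h2688, div_pow, mul_div_assoc', le_div_iff₀ (by positivity)]
  linarith

end Literature.Probability.RandomPlanarGeometry.SAW.Zd

end
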